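/-
Copyright (c) 2026. All rights reserved.
Released under Apache 2.0 license as described in the file LICENSE.
Authors: abc-iut cell, wave-5 discharge seat abc-iut-w5-d067 (sub-node P58ii/L01 of the statements-first
sub-DAG of [AbsTopIII] Prop 5.8 (ii), `plan/L4/SUBDAG-AbsTopIII-Prop58ii-Cor52v.md`).
-/
import Mathlib.FieldTheory.Galois.Infinite
import Mathlib.FieldTheory.KrullTopology
import Literature.AnabelianGeometry.AbsoluteAnabelian.MonoAnalyticLogShells
import Literature.NumberTheory.GaloisRepresentations.AbsGaloisGroup
import Literature.NumberTheory.GaloisRepresentations.CohomologicalDimension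
import Literature.NumberTheory.GaloisRepresentations.LocalReciprocity
import HarnessLib

/-!
# [AbsTopIII] Prop 5.8 (ii), sub-node P58ii/L01: open subgroups of `Ob(TG⊢)` lie in `Ob(TG⊢)` — PROVED

S. Mochizuki, *Topics in absolute anabelian geometry III: global reconstruction algorithms*,
J. Math. Sci. Univ. Tokyo 22 (2015) [MochizukiAbsTopIII2015], Prop 5.8 (ii) (manuscript
`paper:url-5493eb38cbb7` p. 139 l. 25–33) with Def 5.6 (i) p. 134 ("`TG⊢`: the profinite groups isomorphic
to the absolute Galois group of an MLF"; typed by abc-iut-L4-t3 as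
`Literature.AnabelianGeometry.AbsoluteAnabelian.IsMLFGaloisType`) and Def 3.1 (i) p. 66 (`k~ := (𝒪_k̄^×)^pf`
with its `Π_k`-action). The group-theoretic construction of the `Γ⃗×_non`-diagram `𝒪^×_k̄(G) ↪ k̄^×(G) → …`
of Prop 5.8 (ii) runs the local-class-field-theory algorithm of Prop 5.8 (i) AT EVERY OPEN SUBGROUP `J ⊆ G` and
passes to the colimit along the Verlagerung; the licence for that is the classical fact proved here:

* `Prop58ii.openSubgroup_isMLFGaloisType` — for `G ∈ Ob(TG⊢)` and an open subgroup `U ⊆ G`, the profinite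
  group `U` is again in `Ob(TG⊢)`: transporting `U` to an open subgroup of `Gal(k̄/k)`, Krull's Galois
  correspondence (Mathlib `InfiniteGalois`) writes it as `Gal(k̄/E)` for a FINITE subextension `E ⊆ k̄`,
  `Gal(k̄/E) ≅ Gal(Ē/E)` as topological groups (the tree's `algEquivContinuousMulEquivAbsoluteGaloisGroup`),
  and a finite extension of an MLF is an MLF (`[AbsTopI] §0`: "a finite field extension of `ℚ_p`").

Also proved here (junction rows of the same sub-DAG whose inputs are all in the tree): L05a
`Prop58ii.recMapEquivWeilImage` / `recMap_image_units_eq_inertiaImage` (at the model `G = G_K` any reciprocity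
map in the tree's sense `IsLocalReciprocityMap` is an isomorphism `K^× ⥲ Im(W_K) ⊆ G_K^ab` carrying `𝒪_K^×` onto
`Im(I_K)` — the vertices `k^×(G)`, `𝒪^×_k(G)` of (i)/(ii) ARE `k^×`, `𝒪_k^×`), L08
`Prop58ii.fixed_iff_mem_range_algebraMap` / `fixed_algebraicClosure_iff` (the `G`-invariants of `k~ ≅ (k̄,+)` are
the base field, Prop 5.8 (iii) p. 140 l. 8 / Def 5.4 (iii) p. 126; Mathlib `InfiniteGalois`), and Cor 5.2 (v) row
C03 `Cor52v.equivalence_tautological` (p. 120 l. 21–31: the "equivalence `EA⊚ ⥲ An⊚[Th✠]`" is definitional once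
the panalocalization functor exists — objects `(Π, {V⊚(Π)}✠)` retain `Π`, morphisms are DEFINED as those of
`EA⊚`; abstract shape via Mathlib's `inducedFunctor`).

The main theorem is exactly the type of the sub-DAG statement `Prop58ii.OpenSubgroupIsMLFGaloisType` of the companion
statements file `MonoAnalyticLogShellsSub.lean` (filed separately in the review lane; the one-line `_holds` alias
is appended once both are built, so that this proof-only file does not wait on a pending parent). The Galois
part is the universe-polymorphic form of abc-iut-L4's `exists_intermediateField_of_isOpen_absoluteGaloisGroup` /
`nonempty_continuousMulEquiv_fixingSubgroup` (`GaloisSubextensionProofs.lean`, stated there at `Type`; the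
`TG⊢` predicate is universe-polymorphic, so the argument is re-run here at `Type u` as PRIVATE lemmas — adapted, credited).
HONEST FRAMING: refereed classical Galois theory; nothing here bears on [IUTchIII] Cor. 3.12; proof-only file,
no definitions, no named facts.
-/

set_option autoImplicit false

noncomputable section

universe u

namespace Literature.AnabelianGeometry.AbsoluteAnabelian

open Field Literature.NumberTheory.GaloisRepresentations

namespace Prop58ii

/-! ## Krull: open subgroups of `Gal(k̄/k)` are `Gal(k̄/E)`, `E/k` finite (universe-polymorphic form) -/

section Galois

variable (K : Type u) [Field K] [CharZero K]

/-- An open subgroup `N` of `Gal(K̄/K)` (`char K = 0`) is `Gal(K̄/E)` for a finite subextension `E ⊆ K̄` (its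
fixed field) — Mathlib's fundamental theorem of infinite Galois theory, repackaged at `Type u` (adapted from
abc-iut-L4's `exists_intermediateField_of_isOpen_absoluteGaloisGroup`).
[cite: MochizukiAbsTopIII2015, Prop 5.8 (ii) p. 139] -/
private theorem exists_intermediateField_of_isOpen (N : Subgroup (absoluteGaloisGroup K))
    (hN : IsOpen (N : Set (absoluteGaloisGroup K))) :
    ∃ E : IntermediateField K (AlgebraicClosure K), FiniteDimensional K E ∧
      E.fixingSubgroup.comap (absoluteGaloisGroup.toAlgEquiv K).toMonoidHom = N := by
  haveI : IsGalois K (AlgebraicClosure K) := {}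
  have hc : IsClosed (N : Set (absoluteGaloisGroup K)) := N.isClosed_of_isOpen hN
  let N' : ClosedSubgroup (AlgebraicClosure K ≃ₐ[K] AlgebraicClosure K) :=
    ⟨(N : Subgroup (AlgebraicClosure K ≃ₐ[K] AlgebraicClosure K)), hc⟩
  have hfix : (IntermediateField.fixedField N'.1).fixingSubgroup = N'.1 :=
    InfiniteGalois.fixingSubgroup_fixedField N'
  refine ⟨IntermediateField.fixedField N'.1, ?_, ?_⟩
  · rw [← InfiniteGalois.isOpen_iff_finite, hfix]
    exact hN
  · rw [hfix]
    ext σ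
    exact Iff.rfl

omit [CharZero K] in
/-- Restriction of scalars `Gal(K̄/E) → Gal(K̄/K)` is continuous for the Krull topologies (adapted from
abc-iut-L4's private lemma of the same name in `GaloisSubextensionProofs.lean`). [folklore] -/
private theorem continuous_restrictScalars (E : IntermediateField K (AlgebraicClosure K)) :
    Continuous (fun σ : AlgebraicClosure K ≃ₐ[E] AlgebraicClosure K =>
      (σ.restrictScalars K : AlgebraicClosure K ≃ₐ[K] AlgebraicClosure K)) := by
  let φ : (AlgebraicClosure K ≃ₐ[E] AlgebraicClosure K) →*
      (AlgebraicClosure K ≃ₐ[K] AlgebraicClosure K) :=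
    { toFun := fun σ => σ.restrictScalars K
      map_one' := rfl
      map_mul' := fun _ _ => rfl }
  change Continuous φ
  apply continuous_of_continuousAt_one φ (continuousAt_def.mpr _)
  intro N hN
  rw [map_one] at hN
  obtain ⟨M, _, hM⟩ := (krullTopology_mem_nhds_one_iff K (AlgebraicClosure K) N).mp hN
  let b := Module.finBasis K M
  let S : Set (AlgebraicClosure K) := Set.range fun i => (b i : AlgebraicClosure K)
  let M' : IntermediateField E (AlgebraicClosure K) := IntermediateField.adjoin E S
  haveI : FiniteDimensional E M' :=
    IntermediateField.finiteDimensional_adjoin fun x _ => Algebra.IsIntegral.isIntegral x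
  refine (krullTopology_mem_nhds_one_iff E (AlgebraicClosure K) _).mpr
    ⟨M', inferInstance, fun σ hσ => hM ?_⟩
  rw [SetLike.mem_coe, IntermediateField.mem_fixingSubgroup_iff] at hσ
  rw [SetLike.mem_coe, IntermediateField.mem_fixingSubgroup_iff]
  have hb : ∀ i, φ σ (b i : AlgebraicClosure K) = b i := fun i =>
    hσ _ (IntermediateField.subset_adjoin E S ⟨i, rfl⟩)
  have key : ((φ σ).toLinearMap ∘ₗ M.val.toLinearMap) = M.val.toLinearMap :=
    b.ext fun i => hb i
  intro x hx
  exact congr($key ⟨x, hx⟩)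

/-- `Gal(K̄/E) ≅ G_E = Gal(Ē/E)` as topological groups, for a subextension `E ⊆ K̄` of `K` (`char K = 0`),
at `Type u` (adapted from abc-iut-L4's `nonempty_continuousMulEquiv_fixingSubgroup`; Neukirch, *Algebraic Number Theory*,
Ch. IV §1 (1.1)–(1.2)). [cite: NeukirchANT1999, Ch. IV §1 (1.2)] -/
private theorem nonempty_absoluteGaloisGroup_continuousMulEquiv_fixingSubgroup
    (E : IntermediateField K (AlgebraicClosure K)) :
    Nonempty (absoluteGaloisGroup E ≃ₜ*
      ↥(E.fixingSubgroup.comap (absoluteGaloisGroup.toAlgEquiv K).toMonoidHom)) := by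
  haveI : CharZero E := charZero_of_injective_algebraMap (algebraMap K E).injective
  haveI : Algebra.IsAlgebraic E (AlgebraicClosure K) := Algebra.IsAlgebraic.tower_top (K := K) E
  haveI : IsAlgClosure E (AlgebraicClosure K) := ⟨inferInstance, inferInstance⟩
  let e₁ := algEquivContinuousMulEquivAbsoluteGaloisGroup (↥E) (AlgebraicClosure K)
  set N := E.fixingSubgroup.comap (absoluteGaloisGroup.toAlgEquiv K).toMonoidHom with hN
  have hmem : ∀ σ : AlgebraicClosure K ≃ₐ[E] AlgebraicClosure K,
      (absoluteGaloisGroup.toAlgEquiv K).symm (σ.restrictScalars K) ∈ N := by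
    intro σ
    rw [hN, Subgroup.mem_comap]
    change absoluteGaloisGroup.toAlgEquiv K ((absoluteGaloisGroup.toAlgEquiv K).symm _) ∈ _
    rw [MulEquiv.apply_symm_apply, IntermediateField.mem_fixingSubgroup_iff]
    intro x hx
    exact σ.commutes ⟨x, hx⟩
  let ρ : (AlgebraicClosure K ≃ₐ[E] AlgebraicClosure K) →* N :=
    { toFun := fun σ => ⟨_, hmem σ⟩
      map_one' := Subtype.ext rfl
      map_mul' := fun _ _ => Subtype.ext rfl }
  have hρcont : Continuous ρ :=
    Continuous.subtype_mk (continuous_restrictScalars K E) _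
  have hρinj : Function.Injective ρ := by
    intro σ τ h
    have := congrArg (fun x : N => absoluteGaloisGroup.toAlgEquiv K (x : absoluteGaloisGroup K)) h
    exact AlgEquiv.restrictScalars_injective K this
  have hρsurj : Function.Surjective ρ := by
    intro x
    have hx : absoluteGaloisGroup.toAlgEquiv K (x : absoluteGaloisGroup K) ∈ E.fixingSubgroup := x.2
    refine ⟨IntermediateField.fixingSubgroupEquiv E ⟨_, hx⟩, Subtype.ext ?_⟩
    change (absoluteGaloisGroup.toAlgEquiv K).symm _ = _
    rw [MulEquiv.symm_apply_eq]
    exact AlgEquiv.ext fun _ => rfl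
  let hρ : (AlgebraicClosure K ≃ₐ[E] AlgebraicClosure K) ≃ₜ N :=
    Continuous.homeoOfEquivCompactToT2 (f := Equiv.ofBijective ρ ⟨hρinj, hρsurj⟩) hρcont
  let e₂ : (AlgebraicClosure K ≃ₐ[E] AlgebraicClosure K) ≃ₜ* N :=
    { MulEquiv.ofBijective ρ ⟨hρinj, hρsurj⟩ with
      continuous_toFun := hρcont
      continuous_invFun := hρ.symm.continuous }
  exact ⟨e₁.symm.trans e₂⟩

end Galois

/-! ## Finite extensions of MLFs are MLFs -/

/-- A finite extension of an MLF is an MLF ([AbsTopI] §0 p. 7: "a finite field extension of `ℚ_p` for some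
`p`"; `ℚ_p → k → E` with both steps finite). [cite: MochizukiAbsTopI2012, §0 p.7] -/
theorem isMLF_of_finiteDimensional (k : Type u) [Field k] (E : Type u) [Field E] [Algebra k E]
    [FiniteDimensional k E] (hk : IsMLF k) : IsMLF E := by
  obtain ⟨p, hp, f, hfin⟩ := hk.exists_padic
  refine ⟨p, hp, (algebraMap k E).comp f, ?_⟩
  letI : Algebra ℚ_[p] k := f.toAlgebra
  letI : Algebra ℚ_[p] E := ((algebraMap k E).comp f).toAlgebra
  haveI : IsScalarTower ℚ_[p] k E := IsScalarTower.of_algebraMap_eq fun _ => rfl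
  haveI : Module.Finite ℚ_[p] k := hfin
  exact Module.Finite.trans k E

/-! ## P58ii/L01 -/

/-- **[AbsTopIII] Prop 5.8 (ii), sub-node P58ii/L01 — PROVED**: an open subgroup of a profinite group of
MLF-Galois type (`Ob(TG⊢)`, Def 5.6 (i)) is again of MLF-Galois type; this is what allows the algorithm of
Prop 5.8 (i) to be run "at the various open subgroups" when the `Γ⃗×_non`-diagram `𝒪^×_k̄(G) ↪ k̄^×(G) → k~(G)` of
Prop 5.8 (ii) is assembled (p. 139 l. 25–33; Def 3.1 (i) p. 66). Exactly the type of the sub-DAG statement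
`Prop58ii.OpenSubgroupIsMLFGaloisType` (`MonoAnalyticLogShellsSub.lean`).
[cite: MochizukiAbsTopIII2015, Prop 5.8 (ii) p. 139] -/
theorem openSubgroup_isMLFGaloisType (G : ProfiniteGrp.{u}) (hG : IsMLFGaloisType G)
    (U : OpenSubgroup G) :
    IsMLFGaloisType (ProfiniteGrp.ofClosedSubgroup ⟨U.toSubgroup, U.isClosed⟩) := by
  obtain ⟨k, _, _, hk, ⟨e⟩⟩ := hG
  -- transport `U` to an open subgroup `N` of `Gal(k̄/k)`
  let N : Subgroup (absoluteGaloisGroup k) := U.toSubgroup.map (e : G →* absoluteGaloisGroup k)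
  have hNeq : (N : Set (absoluteGaloisGroup k)) = e '' (U : Set G) := Subgroup.coe_map _ _
  have hN : IsOpen (N : Set (absoluteGaloisGroup k)) := by
    rw [hNeq]
    exact e.toHomeomorph.isOpenMap _ U.isOpen
  -- Krull: `N = Gal(k̄/E)` for a finite subextension `E`
  obtain ⟨E, hEfin, hEN⟩ := exists_intermediateField_of_isOpen k N hN
  obtain ⟨e₂⟩ := nonempty_absoluteGaloisGroup_continuousMulEquiv_fixingSubgroup k E
  haveI : CharZero E := charZero_of_injective_algebraMap (algebraMap k E).injective
  -- `U ≃ N ≃ Gal(k̄/E) ≃ G_E`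
  let e₁ : (U.toSubgroup) ≃ₜ* N :=
    { MulEquiv.subgroupMap e.toMulEquiv U.toSubgroup with
      continuous_toFun := Continuous.subtype_mk (e.continuous.comp continuous_subtype_val) _
      continuous_invFun := Continuous.subtype_mk (e.symm.continuous.comp continuous_subtype_val) _ }
  let e₃ : N ≃ₜ* absoluteGaloisGroup E := hEN ▸ e₂.symm
  refine ⟨E, inferInstance, inferInstance, isMLF_of_finiteDimensional k E hk, ⟨?_⟩⟩
  exact e₁.trans e₃


/-! ## Row L05a: at the model, the group-theoretic `k^×(G)`, `𝒪^×_k(G)` ARE `k^×`, `𝒪_k^×` -/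

section Reciprocity

open ValuativeRel

variable (K : Type*) [Field K] [ValuativeRel K] [TopologicalSpace K] [IsNonarchimedeanLocalField K]

/-- **P58ii/L05a** (PROVED; [AbsTopIII] Prop 5.8 (i)(ii) p. 139 l. 15–16 "the images of the embeddings
`𝒪^▷_k ↪ G_k^ab`, `k^× ↪ G_k^ab` of local class field theory [cf. [Mzk9], Proposition 1.2.1, (iii), (iv)]"; Def
3.1 (i)(ii) pp. 66–67, the model MLF-Galois pair): any reciprocity map `θ` in the tree's sense is a group
ISOMORPHISM of `K^×` onto the image of the Weil subgroup in `G_K^ab` — so the vertex `k^×(G)` of the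
group-theoretic `Γ⃗×_non`-diagram at `G = G_K`, which (i) defines as that image, is `K^×` itself.
[cite: MochizukiAbsTopIII2015, Prop 5.8 (ii) p. 139] -/
theorem recMapEquivWeilImage (θ : Kˣ →* absoluteGaloisGroupAbelianization K)
    (hθ : IsLocalReciprocityMap K θ) :
    ∃ e : Kˣ ≃* ((weilSubgroup K).map (absGaloisAbProj K)),
      ∀ x : Kˣ, ((e x : (weilSubgroup K).map (absGaloisAbProj K)) : absoluteGaloisGroupAbelianization K) =
        θ x :=
  ⟨(MonoidHom.ofInjective hθ.injective).trans (MulEquiv.subgroupCongr hθ.range_eq), fun _ => rfl⟩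

/-- **P58ii/L05a, unit part** (PROVED): under the same identification the vertex `𝒪^×_k(G)` — the image of
`𝒪_K^×` — is the image of the inertia subgroup in `G_K^ab` (Prop 5.8 (i) quoting [AbsAnab] Prop 1.2.1 (iii);
Serre, *Local Fields* XIII §4 Cor. to Prop. 13). [cite: MochizukiAbsTopIII2015, Prop 5.8 (ii) p. 139] -/
theorem recMap_image_units_eq_inertiaImage (θ : Kˣ →* absoluteGaloisGroupAbelianization K)
    (hθ : IsLocalReciprocityMap K θ) :
    θ '' ((valuation K).valuationSubring.unitGroup : Set Kˣ) =
      ((absInertia K).map (absGaloisAbProj K) : Set (absoluteGaloisGroupAbelianization K)) := by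
  rw [← hθ.map_unitGroup]
  rfl

end Reciprocity

/-! ## Row L08: the `G`-invariants of `k~ ≅ (k̄, +)` are the base field -/

/-- **P58ii/L08** (PROVED from Mathlib's infinite Galois correspondence; [AbsTopIII] Prop 5.8 (iii) p. 140 l. 8
"the superscript “`G`” denotes the submodule of `G`-invariants"; Def 5.4 (iii) p. 126 l. 30–32
"`𝒪^{Π_k}_{k~} ⊆ ℐ … ⊆ (k~)^{Π_k}`"; Def 3.1 (i) p. 66: `log_k̄ : k~ ⥲ k̄` is `Π_k`-equivariant): transported
along `log_k̄`, the invariants `k~(G)^G` are the elements of `k̄` fixed by `Gal(k̄/k)`, and these are EXACTLY the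
base field `k` — for any Galois extension `K/k`, in particular `K = k̄` in characteristic zero.
[cite: MochizukiAbsTopIII2015, Prop 5.8 (iii) p. 140] -/
theorem fixed_iff_mem_range_algebraMap (k K : Type*) [Field k] [Field K] [Algebra k K] [IsGalois k K]
    (x : K) : (∀ σ : K ≃ₐ[k] K, σ x = x) ↔ x ∈ Set.range (algebraMap k K) :=
  (InfiniteGalois.mem_range_algebraMap_iff_fixed x).symm

/-- **P58ii/L08 at `k̄`** (PROVED): for a field `k` of characteristic zero and its algebraic closure, the
`Gal(k̄/k)`-invariants of `(k̄, +)` are `k`. [cite: MochizukiAbsTopIII2015, Prop 5.8 (iii) p. 140] -/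
theorem fixed_algebraicClosure_iff (k : Type*) [Field k] [CharZero k] (x : AlgebraicClosure k) :
    (∀ σ : AlgebraicClosure k ≃ₐ[k] AlgebraicClosure k, σ x = x) ↔
      x ∈ Set.range (algebraMap k (AlgebraicClosure k)) :=
  haveI : IsGalois k (AlgebraicClosure k) := {}
  fixed_iff_mem_range_algebraMap k (AlgebraicClosure k) x

end Prop58ii

/-! ## Cor 5.2 (v), row C03: the "equivalence" clause is definitional -/

namespace Cor52v

open CategoryTheory

/-- **C52v/L03** (PROVED, abstract shape; [AbsTopIII] Cor 5.2 (v) p. 120 l. 21–31: "Write `An⊚[Th✠]` for the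
category whose objects are data of the form `V✠(Π) := (Π, {V⊚(Π)}✠)` … for `Π ∈ Ob(EA⊚)` and whose morphisms
are the morphisms induced by morphisms of `EA⊚`. Then … the first arrow `EA⊚ → An⊚[Th✠]` is an equivalence of
categories."): a category whose objects are the objects of `C` decorated by the values of ANY object-level
assignment `V` (here: `Π ↦ {V⊚(Π)}✠`, t3's `PanalocalizationExists`/`PanalocalizationMapsHom`) and whose
morphisms are DEFINED to be the morphisms of `C` is equivalent to `C` — in Mathlib's language, the induced
category along the (surjective) first projection. So Cor 5.2 (v)'s equivalence clause carries no proof debt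
beyond the existence of the panalocalization; the contentful neighbour is Rmk 5.2.1 (the composite
`EA⊚ → Th✠` is NOT an equivalence), a negative statement left untyped. [cite: MochizukiAbsTopIII2015, Cor 5.2 (v) p. 120] -/
theorem equivalence_tautological {C : Type u} [Category.{u} C] {D : Type u} (V : C → D) :
    (inducedFunctor (fun x : (Σ c : C, {d : D // d = V c}) => x.1)).IsEquivalence := by
  haveI : (inducedFunctor (fun x : (Σ c : C, {d : D // d = V c}) => x.1)).EssSurj :=
    ⟨fun c => ⟨⟨c, ⟨V c, rfl⟩⟩, ⟨Iso.refl _⟩⟩⟩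
  exact { }

end Cor52v

end Literature.AnabelianGeometry.AbsoluteAnabelian

end
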